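import Mathlib
import Summits.Ventures.HodgeRepro.Tier4.Target
import Summits.Ventures.HodgeRepro.Tier4.Common.TargetData
import Summits.Ventures.HodgeRepro.Tier4.Common.TargetBall
import Summits.Ventures.HodgeRepro.Tier4.Common.TargetCalculus
import Summits.Ventures.HodgeRepro.Tier4.Common.TargetJacobian
import Summits.Ventures.HodgeRepro.Tier4.Common.AutForms
import Summits.Ventures.HodgeRepro.Tier4.LitCompactness
import Summits.Ventures.HodgeRepro.Tier4.Line4.MixedTransfer
import Summits.Ventures.HodgeRepro.Tier4.Line4.Forms11
import Summits.Ventures.HodgeRepro.Tier4.Line4.MixedInvariant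
import Summits.Ventures.HodgeRepro.Tier4.Line4.PullbackWedge
import Summits.Ventures.HodgeRepro.Tier4.Line4.HoloRegularity
import Summits.Ventures.HodgeRepro.Tier4.Line4.MixedClosed
import Summits.Ventures.HodgeRepro.Tier4.Line4.ExactOnBall
import Summits.Ventures.HodgeRepro.Tier4.Line4.WirtingerChain
import Summits.Ventures.HodgeRepro.Tier4.Line3.BallChangeOfVariables
import Summits.Ventures.HodgeRepro.Tier4.Line3.DomainTransfer
import Summits.Ventures.HodgeRepro.Tier4.Line4.DomainUnfold
import Summits.Ventures.HodgeRepro.Tier4.Line4.Partition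
import Summits.Ventures.HodgeRepro.Tier4.Line4.QuotientTiling
import Summits.Ventures.HodgeRepro.Tier4.Line4.StokesQuotient

import Summits.Ventures.HodgeRepro.Tier4.Line4.Cohomology11
import Summits.Ventures.HodgeRepro.Tier4.Line4.WirtingerSchwarz
/-!
# Tier4/Line4/PairDescends — L4.0′ `pair11_descends`: the `(1,1)`-pairing over a fundamental domain descends to
`H^{1,1}(X_{Γ′})` (V2: under the displayed cocompactness and proper discontinuity of the ball action)

Blind re-derivation cell `pub-hodge-repro`, Tier 4 «prove the step» (README §9–§10), seat t4-L4-p2 (prover, LINE L4,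
gen 0).  Tree path `lean/Summits/Ventures/HodgeRepro/Tier4/Line4/PairDescends.lean`.

THE LEMMA (LINE L4 skeleton, t4-plan-4, v0.8 L220 = v0.10 L221, statement VERBATIM; the V2 of this seat's repair census,
STATUS S12320 / S12331): with `hK` = `Lit.BorelHarishChandra1962_Thm11_8_cocompact_hdef E d.H d.τ₀ d.C` (cocompactness,
(K)) and `hP` = `Lit.BorelHarishChandra1962_properlyDiscontinuous_hdef E d.H d.τ₀ d.C` (proper discontinuity, (P)) —
the two PRINTED inputs of Borel–Harish-Chandra 1962 Thm 11.8 in the cell's typed reading (`Tier4/LitCompactness.lean`),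
DISPLAYED as hypotheses — for every level `Γ′`, fundamental domain `D` of `Γ′`, cocycles `ξ, ξ′ ∈ Z11` and coboundaries
`β, β′ ∈ B11`: `pair11 D (ξ + β) (ξ′ + β′) = pair11 D ξ ξ′`.

VOCABULARY.  The skeleton's §2″ definitions `Forms1`, `pull1`, `IsInvariant1`, `Smooth1`, `d11`, `IsPure11`, `onBall`,
`Z11`, `B11` are in `Line4/Cohomology11.lean` (copied VERBATIM from v0.10 L158–L192), with the datum conversions and the
span inductions.

PROOF.  The core is `StokesQuotient.setIntegral_wedge_d11_eq_zero`: `∫_D ⟨ξ ∧ (dη)^{1,1}⟩ = 0` for a closed invariant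
`ξ` and an invariant `η` (tiling + partition of unity + integration by parts + naturality).  Here: (1) the four kinds of
basic products are integrable on `D` (the density of two invariant forms is invariant, `DomainUnfold`); (2) the
pairing of a basic cocycle against a basic coboundary vanishes (the core); of two basic coboundaries as well, because
`(dη)^{1,1}` of a PURE `η` is closed (`isClosed11_d11_of_isPure11`: symmetry of the mixed Wirtinger derivatives of a
`C²` function, `second_derivative_symmetric_of_eventually`) and invariant (`pull_d11_eq`); (3) bilinearity of `pair11` on
`D` and `Submodule.span_induction` on `Z11` / `B11` finish.  `#print axioms pair11_descends` =
`[propext, Classical.choice, Quot.sound]`.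

Nothing here says anything about the status of the Hodge conjecture for CM abelian varieties, which is NOT proved
(HC_CM is NOT proved by anyone in this repository).
-/

set_option autoImplicit false

noncomputable section

open Matrix MeasureTheory NumberField Topology Set
open scoped ComplexConjugate ComplexOrder

namespace Summit.Ventures.HodgeRepro.Tier4.Line4

open Summit.Ventures.HodgeRepro.Tier4 Summit.Ventures.HodgeRepro.Tier4.Line3

variable {F E : Type} [Field F] [NumberField F] [IsGalois ℚ F] [IsCMField F]
  [Field E] [NumberField E] [IsGalois ℚ E] [IsCMField E] (d : TargetData F E)

/-! ## 6. The basic pairs and L4.0′ -/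

section Main

/-- `onBall ξ = ξ` on the ball. -/
theorem onBall_apply_of_mem (ξ : Forms11) {z : Fin 2 → ℂ} (hz : z ∈ ball) : onBall ξ z = ξ z := by
  simp [onBall, hz]

/-- The density of two forms that are both pull-invariant under `ballActions` is invariant. -/
theorem density_invariant_of_pull {Γ' : Set (Matrix (Fin 3) (Fin 3) E)} {a b : Forms11}
    (ha : ∀ φ ∈ ballActions d.τ₀ d.C Γ', ∀ z ∈ ball, pull φ a z = a z)
    (hb : ∀ φ ∈ ballActions d.τ₀ d.C Γ', ∀ z ∈ ball, pull φ b z = b z) {Γ'' : Set (Matrix (Fin 3) (Fin 3) E)}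
    (hΓ : IsCongruenceSubgroup (conjE E) d.H Γ'') (hΓΓ : Γ'' = Γ') :
    ∀ φ ∈ ballActions d.τ₀ d.C Γ', ∀ z ∈ ball, (Complex.normSq (jacDetMap φ z) : ℂ) *
      wedgeCoeff11 (a (φ z)) (b (φ z)) = wedgeCoeff11 (a z) (b z) := by
  subst hΓΓ
  intro φ hφ z hz
  have hφz : DifferentiableAt ℂ φ z := differentiableAt_of_mem_ballActions hΓ (hτ_of_datum d) d.hC hφ hz
  have h := wedgeCoeff11_pull φ a b z
  rw [ha φ hφ z hz, hb φ hφ z hz, det_jacMat_mul_conj hφz] at h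
  exact h.symm

/-- `⟨a ∧ b⟩` is continuous on the ball when the entries of `a`, `b` are. -/
theorem continuousOn_wedgeCoeff11 {a b : Forms11} (ha : ∀ k l, ContinuousOn (fun z => a z k l) ball)
    (hb : ∀ k l, ContinuousOn (fun z => b z k l) ball) :
    ContinuousOn (fun z => wedgeCoeff11 (a z) (b z)) ball := by
  have : (fun z => wedgeCoeff11 (a z) (b z)) = fun z =>
      -(a z 0 0 * b z 1 1 - a z 0 1 * b z 1 0 - a z 1 0 * b z 0 1 + a z 1 1 * b z 0 0) := by
    funext z; simp [wedgeCoeff11]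
  rw [this]
  exact ((((ha 0 0).mul (hb 1 1)).sub ((ha 0 1).mul (hb 1 0))).sub ((ha 1 0).mul (hb 0 1)) |>.add
    ((ha 1 1).mul (hb 0 0))).neg

/-- **Integrability on a fundamental domain** of the density of two invariant forms with continuous entries. -/
theorem integrableOn_wedge_of_invariant (hK : Lit.BorelHarishChandra1962_Thm11_8_cocompact_hdef E d.H d.τ₀ d.C)
    (hP : Lit.BorelHarishChandra1962_properlyDiscontinuous_hdef E d.H d.τ₀ d.C)
    {Γ' : Set (Matrix (Fin 3) (Fin 3) E)} (hΓ' : d.IsLevel Γ') {D : Set (Fin 2 → ℂ)} (hD : d.IsDomain Γ' D)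
    {a b : Forms11} (ha : ∀ φ ∈ ballActions d.τ₀ d.C Γ', ∀ z ∈ ball, pull φ a z = a z)
    (hb : ∀ φ ∈ ballActions d.τ₀ d.C Γ', ∀ z ∈ ball, pull φ b z = b z)
    (hac : ∀ k l, ContinuousOn (fun z => a z k l) ball) (hbc : ∀ k l, ContinuousOn (fun z => b z k l) ball) :
    IntegrableOn (fun z => wedgeCoeff11 (a z) (b z)) D := by
  obtain ⟨χ, -, hχcont, hχ0, ⟨K₁, hK₁c, hK₁b, hχK₁⟩, hpart, -⟩ :=
    exists_partition hΓ'.1 (hτ_of_datum d) d.hC (cocompact_of_lit d hK hΓ') (properlyDiscontinuous_of_lit d hP hΓ')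
  exact (setIntegral_domain_eq_integral_mul_partition hΓ'.1 (hτ_of_datum d) d.hC hD
    (continuousOn_wedgeCoeff11 hac hbc) (density_invariant_of_pull d ha hb hΓ'.1 rfl) hχcont hχ0 hK₁c hK₁b hχK₁
    hpart).1

/-- The entries of a smooth `(1,1)`-form are continuous on the ball. -/
theorem continuousOn_entry_of_smooth11 {ξ : Forms11} (hξ : Smooth11 ξ) (k l : Fin 2) :
    ContinuousOn (fun z => ξ z k l) ball := (hξ k l).continuousOn

/-- The entries of `(dη)^{1,1}` are continuous on the ball for a smooth `η`. -/
theorem continuousOn_d11_entry {η : Forms1} (hη : Smooth1 η) (k l : Fin 2) :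
    ContinuousOn (fun z => d11 η z k l) ball := (contDiffOn_d11_entry hη k l).continuousOn

/-- `(dη)^{1,1}` is pull-invariant under `ballActions` for an invariant smooth `η`. -/
theorem pull_d11_of_invariant1 {Γ' : Set (Matrix (Fin 3) (Fin 3) E)} (hΓ' : d.IsLevel Γ') {η : Forms1}
    (hη : Smooth1 η) (hηi : IsInvariant1 d Γ' η) :
    ∀ φ ∈ ballActions d.τ₀ d.C Γ', ∀ z ∈ ball, pull φ (d11 η) z = d11 η z := fun φ hφ _ hz =>
  pull_d11_eq hΓ'.1 (hτ_of_datum d) d.hC hφ (fun k => (hη k).1.of_le one_le_two)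
    (fun k => (hη k).2.of_le one_le_two) (invariant1_of_datum d hηi φ hφ) hz

/-- **The core, in the datum's terms**: `∫_D ⟨ξ ∧ (dη)^{1,1}⟩ = 0` for a closed invariant `ξ` with `C¹` entries and a
smooth invariant `η`. -/
theorem setIntegral_wedge_d11_eq_zero_datum (hK : Lit.BorelHarishChandra1962_Thm11_8_cocompact_hdef E d.H d.τ₀ d.C)
    (hP : Lit.BorelHarishChandra1962_properlyDiscontinuous_hdef E d.H d.τ₀ d.C)
    {Γ' : Set (Matrix (Fin 3) (Fin 3) E)} (hΓ' : d.IsLevel Γ') {D : Set (Fin 2 → ℂ)} (hD : d.IsDomain Γ' D)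
    {ξ : Forms11} (hξs : ∀ k l, ContDiffOn ℝ 1 (fun z => ξ z k l) ball) (hξc : IsClosed11 ξ)
    (hξi : ∀ φ ∈ ballActions d.τ₀ d.C Γ', ∀ z ∈ ball, pull φ ξ z = ξ z) {η : Forms1} (hη : Smooth1 η)
    (hηi : IsInvariant1 d Γ' η) : ∫ z in D, wedgeCoeff11 (ξ z) (d11 η z) = 0 :=
  setIntegral_wedge_d11_eq_zero hΓ'.1 (hτ_of_datum d) d.hC (cocompact_of_lit d hK hΓ')
    (properlyDiscontinuous_of_lit d hP hΓ') hD hξs hξc hξi (fun k => (hη k).1) (fun k => (hη k).2)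
    (invariant1_of_datum d hηi)

/-- **L4.0′ `pair11_descends`** (LINE L4 skeleton v0.8 L220 = v0.10 L221, VERBATIM) — (K) cocompactness `hK` and (P)
proper discontinuity `hP` of the ball action of every level (`LitCompactness`); then for a fundamental domain `D` of
`Γ′`, the pairing of cocycles depends only on classes: adding a coboundary to either argument does not change it. -/
theorem pair11_descends (hK : Lit.BorelHarishChandra1962_Thm11_8_cocompact_hdef E d.H d.τ₀ d.C)
    (hP : Lit.BorelHarishChandra1962_properlyDiscontinuous_hdef E d.H d.τ₀ d.C)
    (Γ' : Set (Matrix (Fin 3) (Fin 3) E)) (hΓ' : d.IsLevel Γ') (D : Set (Fin 2 → ℂ))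
    (hD : d.IsDomain Γ' D) (ξ ξ' : Forms11) (hξ : ξ ∈ Z11 d Γ') (hξ' : ξ' ∈ Z11 d Γ')
    (β β' : Forms11) (hβ : β ∈ B11 d Γ') (hβ' : β' ∈ B11 d Γ') :
    pair11 D (ξ + β) (ξ' + β') = pair11 D ξ ξ' := by
  have hDb : D ⊆ ball := hD.2.1
  have hDm : MeasurableSet D := hD.1
  -- the generating sets
  set SZ : Set Forms11 := {ζ | ∃ ξ : Forms11, Smooth11 ξ ∧ IsClosed11 ξ ∧ IsInvariant11 d Γ' ξ ∧ ζ = onBall ξ} with hSZ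
  set SB : Set Forms11 := {ζ | ∃ η : Forms1, Smooth1 η ∧ IsInvariant1 d Γ' η ∧ IsPure11 η ∧ ζ = onBall (d11 η)}
    with hSB
  have hξZ : ξ ∈ Submodule.span ℂ SZ := hξ
  have hξ'Z : ξ' ∈ Submodule.span ℂ SZ := hξ'
  have hβB : β ∈ Submodule.span ℂ SB := hβ
  have hβ'B : β' ∈ Submodule.span ℂ SB := hβ'
  -- the basic pairs
  have hZZ : ∀ a ∈ SZ, ∀ b ∈ SZ, IntegrableOn (fun z => wedgeCoeff11 (a z) (b z)) D := by
    rintro a ⟨ξ₁, hs₁, -, hi₁, rfl⟩ b ⟨ξ₂, hs₂, -, hi₂, rfl⟩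
    refine (integrableOn_wedge_of_invariant d hK hP hΓ' hD (invariant11_of_datum d hi₁) (invariant11_of_datum d hi₂)
      (continuousOn_entry_of_smooth11 hs₁) (continuousOn_entry_of_smooth11 hs₂)).congr_fun (fun z hz => ?_) hDm
    simp only [onBall_apply_of_mem _ (hDb hz)]
  have hZB : ∀ a ∈ SZ, ∀ b ∈ SB, IntegrableOn (fun z => wedgeCoeff11 (a z) (b z)) D ∧ pair11 D a b = 0 := by
    rintro a ⟨ξ₁, hs₁, hc₁, hi₁, rfl⟩ b ⟨η, hsη, hiη, -, rfl⟩
    refine ⟨(integrableOn_wedge_of_invariant d hK hP hΓ' hD (invariant11_of_datum d hi₁)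
      (pull_d11_of_invariant1 d hΓ' hsη hiη) (continuousOn_entry_of_smooth11 hs₁)
      (continuousOn_d11_entry hsη)).congr_fun (fun z hz => ?_) hDm, ?_⟩
    · simp only [onBall_apply_of_mem _ (hDb hz)]
    · show ∫ z in D, wedgeCoeff11 (onBall ξ₁ z) (onBall (d11 η) z) = 0
      rw [setIntegral_congr_fun hDm fun z hz => by
        simp only [onBall_apply_of_mem _ (hDb hz)]; rfl]
      exact setIntegral_wedge_d11_eq_zero_datum d hK hP hΓ' hD (fun k l => (hs₁ k l).of_le one_le_two) hc₁
        (invariant11_of_datum d hi₁) hsη hiη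
  have hBZ : ∀ a ∈ SB, ∀ b ∈ SZ, IntegrableOn (fun z => wedgeCoeff11 (a z) (b z)) D ∧ pair11 D a b = 0 := by
    intro a ha b hb
    obtain ⟨hi, h0⟩ := hZB b hb a ha
    refine ⟨hi.congr_fun (fun z _ => wedgeCoeff11_comm _ _) hDm, ?_⟩
    show ∫ z in D, wedgeCoeff11 (a z) (b z) = 0
    rw [setIntegral_congr_fun hDm fun z _ => wedgeCoeff11_comm (a z) (b z)]
    exact h0
  have hBB : ∀ a ∈ SB, ∀ b ∈ SB, IntegrableOn (fun z => wedgeCoeff11 (a z) (b z)) D ∧ pair11 D a b = 0 := by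
    rintro a ⟨η₁, hs₁, hi₁, hp₁, rfl⟩ b ⟨η₂, hs₂, hi₂, -, rfl⟩
    refine ⟨(integrableOn_wedge_of_invariant d hK hP hΓ' hD (pull_d11_of_invariant1 d hΓ' hs₁ hi₁)
      (pull_d11_of_invariant1 d hΓ' hs₂ hi₂) (continuousOn_d11_entry hs₁)
      (continuousOn_d11_entry hs₂)).congr_fun (fun z hz => ?_) hDm, ?_⟩
    · simp only [onBall_apply_of_mem _ (hDb hz)]
    · show ∫ z in D, wedgeCoeff11 (onBall (d11 η₁) z) (onBall (d11 η₂) z) = 0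
      rw [setIntegral_congr_fun hDm fun z hz => by
        simp only [onBall_apply_of_mem _ (hDb hz)]; rfl]
      exact setIntegral_wedge_d11_eq_zero_datum d hK hP hΓ' hD (contDiffOn_d11_entry hs₁)
        (isClosed11_d11_of_isPure11 hs₁ hp₁) (pull_d11_of_invariant1 d hΓ' hs₁ hi₁) hs₂ hi₂
  -- the spans
  have iZZ := integrableOn_wedge_of_span D hZZ hξZ hξ'Z
  obtain ⟨iZB, vZB⟩ := pair11_eq_zero_of_span D hZB hξZ hβ'B
  obtain ⟨iBZ, vBZ⟩ := pair11_eq_zero_of_span D hBZ hβB hξ'Z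
  obtain ⟨iBB, vBB⟩ := pair11_eq_zero_of_span D hBB hβB hβ'B
  -- bilinearity
  show ∫ z in D, wedgeCoeff11 ((ξ + β) z) ((ξ' + β') z) = ∫ z in D, wedgeCoeff11 (ξ z) (ξ' z)
  simp only [Pi.add_apply, wedgeCoeff11_add_left, wedgeCoeff11_add_right]
  have i1 : IntegrableOn (fun z => wedgeCoeff11 (ξ z) (ξ' z) + wedgeCoeff11 (β z) (ξ' z)) D := iZZ.add iBZ
  have i2 : IntegrableOn (fun z => wedgeCoeff11 (ξ z) (β' z) + wedgeCoeff11 (β z) (β' z)) D := iZB.add iBB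
  rw [integral_add i1 i2, integral_add iZZ iBZ, integral_add iZB iBB]
  have e1 : ∫ z in D, wedgeCoeff11 (ξ z) (β' z) = 0 := vZB
  have e2 : ∫ z in D, wedgeCoeff11 (β z) (ξ' z) = 0 := vBZ
  have e3 : ∫ z in D, wedgeCoeff11 (β z) (β' z) = 0 := vBB
  rw [e1, e2, e3]
  ring

end Main

end Summit.Ventures.HodgeRepro.Tier4.Line4

end
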